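/-
Copyright: lit-balaban cell, Phase-2 proof seat p33 (gen 7).  Statement-level skeleton of a published paper; no proof claims beyond
what the kernel checks below.
-/
import Literature.MathematicalPhysics.QuantumFieldTheory.BalabanImbrieJaffe1984to88.BIJ85Claim73Residual
import Literature.MathematicalPhysics.QuantumFieldTheory.BalabanImbrieJaffe1984to88.BIJ85Ineq723TorusCE
import Literature.MathematicalPhysics.QuantumFieldTheory.BalabanImbrieJaffe1984to88.BIJ88Decay216Native

/-!
# `BalabanImbrieJaffe1984to88.BIJ85Claim73ActualOne` — T. Bałaban, J. Imbrie, A. Jaffe, *Renormalization of the Higgs model: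
minimizers, propagators and the stability of mean field theory*, Commun. Math. Phys. **97** (1985) 299–329
[BalabanImbrieJaffe1985]: **THE FIRST RENORMALIZATION STEP, HYPOTHESIS-FREE — (7.3.1) ⇒ (7.3.2) for the ACTUAL background `u₁` of
(4.5.4) at `k = 1` on EVERY torus** (p. 306: *"In particular we will establish strict positivity of σ₁ and Δ₁(u₁) in (3.8)"*; the `σ₁` half is
gen 2's `BIJ85SigmaPositivity`).  At `k = 1` the hierarchical sum (4.4.4) has the single term `j = 0`: `H₀ = I` (the Landau minimizer with the
trivial constraint `Q₀ = I`) and `𝒟₁ = C^{(0)}`, so the located sup-norm property of the residual operator `R₁ = (I − ∂𝒟₁∂^*)Q^{e*}` (file B's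
index field `hR`) FOLLOWS from p09's hypothesis-free (7.2.3) for `C^{(0)}` (`BIJ85Ineq723TorusCE.ineq723_CE`), the uniform lattice sums of
`B3TorusRadialSums`, r18's rescaling `BIJ88Decay216Native.cE_eq_smul_cE_one`, and the elementary sup-norms of `Q^{e*}`, `∂^*`, `∂`: constant
`K₁ = L²(1 + 16d·M_C·d·(2(1 + d/δ_C))^d)` from `(d, L)` only.  Hence r15's `Claim73 𝓅` for the family of ACTUAL first-step data over all tori
with given `(d, L)`, all `0 < e ≤ 1`, ALL unit-lattice `U(1)` fields `v` — no located hypothesis left.  File C of this seat's gen-7 member of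
SKELETON row **C1.Eq7.3.1-7.3.2** (owner r15, referee ref-5); files A `BIJ85Eq454PlaqResidual`, B `BIJ85Claim73Residual`.

statement-level skeleton of published theorems with citation tags; proofs where landed; nothing here is a claim about the Yang–Mills mass gap

PDF held: `paper:balaban1985-cmp97-bij-higgs-minimizers` (journal page = PDF page + 298).  Pages read this session (`lit read`, OCR text):
p. 306–308 [PDF 8–10] (Sect. 3, (3.8), (3.15), (3.21)), p. 311–313 [PDF 13–15] ((4.3.3)–(4.4.4), (4.5.4)), p. 325–326 [PDF 27–28].

CITATION HEADER (lean-in-tree rule).  Phase-2 file of the lit-balaban TYPED SKELETON (HOME `run/shared/lean/pub/lit-balaban/`), seat p33 gen 7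
(unit `lit-balaban-p33-g7`; TAKING line HOME/STATUS.md 2026-08-21T18:54:37Z).  Objects BY NAME: p11's `HkE`/`CE`/`DkE`/`HkE_apply`
(`BIJ85Prop522Torus`), `Hk_spec_V1`/`opsV1_Qk` (`BIJ85LandauMinimizer442V1`), p09's `ineq723_CE`/`inner_toEj_single_left`/`toEj_single`, r18's
`cE_eq_smul_cE_one`, `B3TorusRadialSums.sum_exp_neg_supDist_le`, p30's `QesOp_apply`/`toU`, `BIJ85Eq531Inputs.QestarIter_succ`,
`BIJ85CellAverages.Cells.Qstar_of_mem`/`Qstar_of_not_mem`, files A–B.  Definitions with bodies: `K1` (the constant), `OneIdx` (index of the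
first-step family), `OneIdx.toResIdx`.  No `def … : Prop`, no named fact (D-0026).

THE PRINTED TEXT, verbatim.  p. 312 [PDF 14]: *"𝒟_k = Σ_{j=0}^{k−1} H_jC^{(j)}H_j^*. (4.4.4) Here the transformations H_j are now defined by the same
formulas as (4.4.2); however, they act on the η = L^{−k} lattice instead of the L^{−j} lattice and they involve j^{th} order averages Q_j."*;
p. 306 [PDF 8]: *"The quadratic form has the structure S_Q^{(1)} = ½⟨f^{(1)},σ₁f^{(1)}⟩ + ½⟨ψ,Δ₁(u₁)ψ⟩ (3.8) which we now derive and analyze. In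
particular we will establish strict positivity of σ₁ and Δ₁(u₁) in (3.8)."*; p. 326 [PDF 28]: (7.3.1)–(7.3.2) as in file B.

WHAT IS PROVED (0 `sorry`, standard axioms).
* §1 sup-norm plumbing on Euclidean carriers: `eq_sum_single` (basis expansion), `abs_apply_le_rowSum` (`|(Tx)_i| ≤ (Σ_j|Te_j(i)|)·max|x|`),
  `adjoint_apply_eq_sum`/`abs_adjoint_apply_le` (`|(T†y)_j| ≤ (Σ_i|Te_j(i)|)·max|y|`).
* §2 the elementary operators: `abs_QestarIter_le` (`|Q^{e*}_kg| ≤ L^{2k}max|g|`), `abs_QesOp_le`, `abs_curl_le` (`|∂A(p)| ≤ 4|c|max|A|`),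
  `sum_abs_curl_single_le` (`Σ_p|∂δ_b(p)| ≤ 4d|c|`: each bond bounds at most `d` plaquettes per position), `abs_adjoint_curlOp_le`
  (`|(∂^*F)_b| ≤ 4d√w|c|·max|F|`).
* §3 **`HkE_zero`** (`H₀ = I`: the constraint `Q₀A = B` is `A = B`), **`DkE_one`** (`𝒟₁ = C^{(0)}`, (4.4.4) at `k = 1`), `rowSum_CE_zero_le`
  (`Σ_{b′}|⟨e_b, C^{(0)}e_{b′}⟩| ≤ M_C·d·(2(1+d/δ_C))^d` at the native weights, from (7.2.3)), **`resBound_one`** (the residual property at `k = 1` on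
  every torus with `P.d = d`, `P.L = L`, `1 ≤ m + K`: `|f₁(p)| ≤ K₁·max|f|`, `K₁ = K₁(d, L)`).
* §4 `K1`, `OneIdx d L`, `OneIdx.toResIdx`; **`claim73_actual_one`**: `Claim73 𝓅` for the actual first-step family — `γ = min(a/(9(d+1)), 1/12)`,
  `α = ½`, `M = (4/3)d⁴((π/2)K₁)²(1+4𝓅₊)^{2𝓅₊}` — and `hyp731_one_iff` spelling the hypothesis as the printed `|v(∂p′) − 1| ≤ e𝓅(e)`.
HONEST SCOPE.  `k = 1` only (the general-`k` residual property is file B's located input); first printed form of (7.3.2); `0 < e ≤ 1`; `L` enters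
the constants (as everywhere in the paper); no optimization of constants.
-/

open scoped RealInnerProductSpace BigOperators
open Finset

namespace Literature.MathematicalPhysics.QuantumFieldTheory.BalabanImbrieJaffe1984to88.BIJ85Claim73ActualOne

open Literature.MathematicalPhysics.QuantumFieldTheory.Balaban1983to89
open LatticeFieldCalculus (curl supDist shiftEquiv)
open BIJ88Sect3Statements (U1 toC)
open BIJ85Sect1Model (U1Field plaq)
open BIJ85AxialPropagator411 (BondSpace PlaqSpace curlOp V411 toE)
open BIJ85Prop521Torus (CoarseSpace toEj)
open BIJ85Prop522Torus (HkE CE DkE HkE_apply)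
open BIJ85LandauMinimizer442 (Hk)
open BIJ85LandauMinimizer442V1 (opsV1 Hk_spec_V1 opsV1_Qk)
open BIJ85SigmaForm421 (curlG)
open BIJ85Sigma421Torus (toU QesOp UnitPlaqSpace QesOp_apply)
open BIJ85Sigma422Eta (eta_pos eta_inv)
open BIJ85Eq531Inputs (QestarIter QestarIter_zero QestarIter_succ)
open BIJ85CurlQsstar (torusEdgeCells)
open B3TorusRadialSums (sum_exp_neg_supDist_le)
open BIJ85Ineq723TorusCE (ineq723_CE inner_toEj_single_left toEj_single)
open BIJ88Decay216Native (cE_eq_smul_cE_one)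
open BIJ85Eq454PlaqResidual BIJ85Claim73Residual

noncomputable section

/-! ## §1 Sup-norm plumbing on Euclidean carriers -/

section Plumbing

variable {ι κ : Type*} [Fintype ι] [DecidableEq ι]

/-- kernel: the basis expansion `x = Σ_j x_j e_j` in `ℝ^ι`. [folklore] -/
private theorem eq_sum_single (x : EuclideanSpace ℝ ι) : x = ∑ j, x j • EuclideanSpace.single j (1 : ℝ) := by
  ext i
  simp [Finset.sum_apply, Pi.single_apply]

/-- kernel (row sums control the sup norm): for a linear map `T : ℝ^ι → ℝ^κ` and `|x_j| ≤ C` for all `j`,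
`|(Tx)_i| ≤ (Σ_j |(Te_j)_i|)·C`. [folklore] -/
private theorem abs_apply_le_rowSum (T : EuclideanSpace ℝ ι →ₗ[ℝ] EuclideanSpace ℝ κ) {x : EuclideanSpace ℝ ι} {C : ℝ}
    (hx : ∀ j, |x j| ≤ C) (i : κ) :
    |T x i| ≤ (∑ j, |T (EuclideanSpace.single j 1) i|) * C := by
  have hC : ∀ j, 0 ≤ C := fun j => (abs_nonneg _).trans (hx j)
  conv_lhs => rw [eq_sum_single x, map_sum]
  simp only [map_smul]
  rw [show (∑ j, x j • T (EuclideanSpace.single j 1)) i = ∑ j, x j * T (EuclideanSpace.single j 1) i by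
    simp [Finset.sum_apply]]
  calc |∑ j, x j * T (EuclideanSpace.single j 1) i| ≤ ∑ j, |x j * T (EuclideanSpace.single j 1) i| := abs_sum_le_sum_abs _ _
    _ = ∑ j, |T (EuclideanSpace.single j 1) i| * |x j| := by simp_rw [abs_mul, mul_comm]
    _ ≤ ∑ j, |T (EuclideanSpace.single j 1) i| * C :=
        sum_le_sum fun j _ => mul_le_mul_of_nonneg_left (hx j) (abs_nonneg _)
    _ = (∑ j, |T (EuclideanSpace.single j 1) i|) * C := by rw [sum_mul]

/-- kernel: the entries of the adjoint, `(T†y)_j = Σ_i (Te_j)_i·y_i`. [folklore] -/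
private theorem adjoint_apply_eq_sum [Fintype κ] (T : EuclideanSpace ℝ ι →ₗ[ℝ] EuclideanSpace ℝ κ) (y : EuclideanSpace ℝ κ) (j : ι) :
    LinearMap.adjoint T y j = ∑ i, T (EuclideanSpace.single j 1) i * y i := by
  have h := EuclideanSpace.inner_single_left j (1 : ℝ) (LinearMap.adjoint T y)
  rw [map_one, one_mul, LinearMap.adjoint_inner_right] at h
  rw [← h, PiLp.inner_apply]
  simp [mul_comm]

/-- kernel (column sums control the sup norm of the adjoint): `|(T†y)_j| ≤ (Σ_i |(Te_j)_i|)·C` whenever `|y_i| ≤ C`. [folklore] -/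
private theorem abs_adjoint_apply_le [Fintype κ] (T : EuclideanSpace ℝ ι →ₗ[ℝ] EuclideanSpace ℝ κ) {y : EuclideanSpace ℝ κ} {C : ℝ}
    (hy : ∀ i, |y i| ≤ C) (j : ι) :
    |LinearMap.adjoint T y j| ≤ (∑ i, |T (EuclideanSpace.single j 1) i|) * C := by
  rw [adjoint_apply_eq_sum]
  calc |∑ i, T (EuclideanSpace.single j 1) i * y i| ≤ ∑ i, |T (EuclideanSpace.single j 1) i * y i| := abs_sum_le_sum_abs _ _
    _ = ∑ i, |T (EuclideanSpace.single j 1) i| * |y i| := by simp_rw [abs_mul]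
    _ ≤ ∑ i, |T (EuclideanSpace.single j 1) i| * C :=
        sum_le_sum fun i _ => mul_le_mul_of_nonneg_left (hy i) (abs_nonneg _)
    _ = (∑ i, |T (EuclideanSpace.single j 1) i|) * C := by rw [sum_mul]

end Plumbing

/-! ## §2 The elementary operators `Q^{e*}_k`, `∂`, `∂^*` in the sup norm -/

variable {P : Params}

/-- **`|(Q^{e*}_kg)(p)| ≤ L^{2k}·max|g|`** — the k-fold composite of (2.22) `(Q^{e*}f)(p) = L²f(p′)` on `B^e(p′)`, `0` otherwise (`2 ≤ d`).
[cite: BalabanImbrieJaffe1985, (2.22) p.305] -/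
theorem abs_QestarIter_le (hd : 2 ≤ P.d) : ∀ (k : ℕ) (g : Balaban1983to89.Plaq P k → ℝ) (C : ℝ), (∀ q, |g q| ≤ C) →
    ∀ p : Balaban1983to89.Plaq P 0, |QestarIter hd k g p| ≤ ((P.L : ℝ) ^ 2) ^ k * C
  | 0, g, C, hg, p => by simpa using hg p
  | k + 1, g, C, hg, p => by
    rw [QestarIter_succ]
    have hL : (0 : ℝ) ≤ (P.L : ℝ) ^ 2 := by positivity
    have hC : 0 ≤ C := (abs_nonneg _).trans (hg ⟨default, ⟨0, by omega⟩, ⟨1, by omega⟩, by simp [Fin.lt_def]⟩)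
    have h1 : ∀ q, |(torusEdgeCells P k hd).Qstar g q| ≤ (P.L : ℝ) ^ 2 * C := by
      intro q
      by_cases hq : ∃ c, q ∈ (torusEdgeCells P k hd).B c
      · obtain ⟨c, hc⟩ := hq
        rw [(torusEdgeCells P k hd).Qstar_of_mem g hc, show (torusEdgeCells P k hd).m = 2 from rfl,
          show ((torusEdgeCells P k hd).L : ℝ) = P.L from rfl, abs_mul, abs_of_nonneg hL]
        exact mul_le_mul_of_nonneg_left (hg c) hL
      · push Not at hq
        rw [(torusEdgeCells P k hd).Qstar_of_not_mem g hq, abs_zero]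
        positivity
    calc |QestarIter hd k ((torusEdgeCells P k hd).Qstar g) p| ≤ ((P.L : ℝ) ^ 2) ^ k * ((P.L : ℝ) ^ 2 * C) :=
          abs_QestarIter_le hd k _ _ h1 p
      _ = ((P.L : ℝ) ^ 2) ^ (k + 1) * C := by ring

/-- `|(√w·Q^{e*}_kF)(p)| ≤ √w·L^{2k}·max|F|` for p30's `QesOp` (`w ≥ 0`, `2 ≤ d`). [cite: BalabanImbrieJaffe1985, (4.2.1) p.310] -/
theorem abs_QesOp_le (hd : 2 ≤ P.d) (w : ℝ) (k : ℕ) (F : UnitPlaqSpace P k) {C : ℝ} (hF : ∀ q, |F q| ≤ C)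
    (p : Balaban1983to89.Plaq P 0) :
    |QesOp (P := P) hd w k F p| ≤ Real.sqrt w * ((P.L : ℝ) ^ 2) ^ k * C := by
  rw [QesOp_apply, abs_mul, abs_of_nonneg (Real.sqrt_nonneg w), mul_assoc]
  exact mul_le_mul_of_nonneg_left (abs_QestarIter_le hd k (fun q => F q) C hF p) (Real.sqrt_nonneg w)

/-- **`|(∂A)(p)| ≤ 4|c|·max|A|`** — the plaquette sum of (2.5)/(4.1.1) has four bonds. [cite: BalabanImbrieJaffe1985, (2.5) p.302] -/
theorem abs_curl_le {j : ℕ} (c : ℝ) (A : VecField P j ℝ) {C : ℝ} (hA : ∀ b, |A b| ≤ C) (p : Balaban1983to89.Plaq P j) :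
    |curl c A p| ≤ 4 * |c| * C := by
  unfold curl
  rw [smul_eq_mul, abs_mul]
  have h := abs_add_le (A ⟨p.src, p.μ⟩ + A ⟨p.src.shift p.μ, p.ν⟩ - A ⟨p.src.shift p.ν, p.μ⟩) (-A ⟨p.src, p.ν⟩)
  have h' := abs_sub (A ⟨p.src, p.μ⟩ + A ⟨p.src.shift p.μ, p.ν⟩) (A ⟨p.src.shift p.ν, p.μ⟩)
  have h'' := abs_add_le (A ⟨p.src, p.μ⟩) (A ⟨p.src.shift p.μ, p.ν⟩)
  have e1 : A ⟨p.src, p.μ⟩ + A ⟨p.src.shift p.μ, p.ν⟩ - A ⟨p.src.shift p.ν, p.μ⟩ - A ⟨p.src, p.ν⟩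
      = A ⟨p.src, p.μ⟩ + A ⟨p.src.shift p.μ, p.ν⟩ - A ⟨p.src.shift p.ν, p.μ⟩ + -A ⟨p.src, p.ν⟩ := by ring
  rw [e1]
  have := hA ⟨p.src, p.μ⟩; have := hA ⟨p.src.shift p.μ, p.ν⟩; have := hA ⟨p.src.shift p.ν, p.μ⟩; have := hA ⟨p.src, p.ν⟩
  rw [abs_neg] at h
  nlinarith [abs_nonneg c]

/-- kernel: a bond is the `i`-th boundary bond of at most `d` positively oriented plaquettes — the four boundary maps
`p ↦ ⟨x, μ⟩, ⟨x+e_μ, ν⟩, ⟨x+e_ν, μ⟩, ⟨x, ν⟩` have fibres of size `≤ d` (a complementary direction determines the plaquette).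
[cite: BalabanImbrieJaffe1985, (2.5) p.302] -/
theorem card_filter_bond_le {j : ℕ} [DecidableEq (PBond P j)] (t : Balaban1983to89.Plaq P j → PBond P j)
    (π : Balaban1983to89.Plaq P j → Fin P.d) (hinj : ∀ p p', t p = t p' → π p = π p' → p = p') (b : PBond P j) :
    (univ.filter fun p => t p = b).card ≤ P.d := by
  calc (univ.filter fun p => t p = b).card ≤ (univ : Finset (Fin P.d)).card := by
        refine Finset.card_le_card_of_injOn π (fun _ _ => mem_univ _) ?_
        intro p hp p' hp' hπ
        simp only [coe_filter, mem_univ, true_and, Set.mem_setOf_eq] at hp hp'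
        exact hinj p p' (hp.trans hp'.symm) hπ
    _ = P.d := by simp

/-- kernel: the shift of a site is injective. [folklore] -/
private theorem shift_injective {j : ℕ} (μ : Fin P.d) : Function.Injective fun x : Balaban1983to89.Site P j => x.shift μ :=
  (LatticeFieldCalculus.shiftEquiv (P := P) (j := j) μ).injective

/-- **`Σ_p |(∂δ_b)(p)| ≤ 4d|c|`** for the indicator `δ_b` of a bond (each of the four boundary positions is taken by `b` in at most `d`
plaquettes). [cite: BalabanImbrieJaffe1985, (2.5) p.302] -/
theorem sum_abs_curl_single_le {j : ℕ} [DecidableEq (PBond P j)] (c : ℝ) (b : PBond P j) :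
    ∑ p : Balaban1983to89.Plaq P j, |curl c (fun b' => if b' = b then (1 : ℝ) else 0) p| ≤ 4 * P.d * |c| := by
  set δ : PBond P j → ℝ := fun b' => if b' = b then (1 : ℝ) else 0 with hδ
  have hδ' : ∀ b', |δ b'| = if b' = b then 1 else 0 := fun b' => by
    simp only [hδ]; split_ifs <;> simp
  -- the four boundary maps and their fibre counts
  have hcount : ∀ (t : Balaban1983to89.Plaq P j → PBond P j) (π : Balaban1983to89.Plaq P j → Fin P.d),
      (∀ p p', t p = t p' → π p = π p' → p = p') → ∑ p : Balaban1983to89.Plaq P j, |δ (t p)| ≤ P.d := by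
    intro t π hinj
    have h1 : ∑ p : Balaban1983to89.Plaq P j, |δ (t p)| = ((univ.filter fun p => t p = b).card : ℝ) := by
      simp_rw [hδ']
      rw [Finset.sum_boole]
    rw [h1]
    exact_mod_cast card_filter_bond_le t π hinj b
  have e1 : ∀ p : Balaban1983to89.Plaq P j, |curl c δ p| ≤ |c| * (|δ ⟨p.src, p.μ⟩| + |δ ⟨p.src.shift p.μ, p.ν⟩|
      + |δ ⟨p.src.shift p.ν, p.μ⟩| + |δ ⟨p.src, p.ν⟩|) := by
    intro p
    unfold curl
    rw [smul_eq_mul, abs_mul]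
    refine mul_le_mul_of_nonneg_left ?_ (abs_nonneg c)
    have h1 := abs_sub (δ ⟨p.src, p.μ⟩ + δ ⟨p.src.shift p.μ, p.ν⟩ - δ ⟨p.src.shift p.ν, p.μ⟩) (δ ⟨p.src, p.ν⟩)
    have h2 := abs_sub (δ ⟨p.src, p.μ⟩ + δ ⟨p.src.shift p.μ, p.ν⟩) (δ ⟨p.src.shift p.ν, p.μ⟩)
    have h3 := abs_add_le (δ ⟨p.src, p.μ⟩) (δ ⟨p.src.shift p.μ, p.ν⟩)
    linarith
  -- injectivity of the complementary direction on each fibre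
  have hA : ∀ p p' : Balaban1983to89.Plaq P j, (⟨p.src, p.μ⟩ : PBond P j) = ⟨p'.src, p'.μ⟩ → p.ν = p'.ν → p = p' := by
    rintro ⟨x, μ, ν, h⟩ ⟨x', μ', ν', h'⟩ h1 h2
    simp only [PBond.mk.injEq] at h1
    obtain ⟨rfl, rfl⟩ := h1; simp only at h2; subst h2; rfl
  have hB : ∀ p p' : Balaban1983to89.Plaq P j, (⟨p.src.shift p.μ, p.ν⟩ : PBond P j) = ⟨p'.src.shift p'.μ, p'.ν⟩ → p.μ = p'.μ →
      p = p' := by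
    rintro ⟨x, μ, ν, h⟩ ⟨x', μ', ν', h'⟩ h1 h2
    simp only [PBond.mk.injEq] at h1
    simp only at h2; subst h2
    obtain ⟨hx, rfl⟩ := h1
    have := shift_injective μ hx
    subst this; rfl
  have hC : ∀ p p' : Balaban1983to89.Plaq P j, (⟨p.src.shift p.ν, p.μ⟩ : PBond P j) = ⟨p'.src.shift p'.ν, p'.μ⟩ → p.ν = p'.ν →
      p = p' := by
    rintro ⟨x, μ, ν, h⟩ ⟨x', μ', ν', h'⟩ h1 h2
    simp only [PBond.mk.injEq] at h1
    simp only at h2; subst h2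
    obtain ⟨hx, rfl⟩ := h1
    have := shift_injective ν hx
    subst this; rfl
  have hD : ∀ p p' : Balaban1983to89.Plaq P j, (⟨p.src, p.ν⟩ : PBond P j) = ⟨p'.src, p'.ν⟩ → p.μ = p'.μ → p = p' := by
    rintro ⟨x, μ, ν, h⟩ ⟨x', μ', ν', h'⟩ h1 h2
    simp only [PBond.mk.injEq] at h1
    obtain ⟨rfl, rfl⟩ := h1; simp only at h2; subst h2; rfl
  have s1 := hcount (fun p => ⟨p.src, p.μ⟩) (fun p => p.ν) hA
  have s2 := hcount (fun p => ⟨p.src.shift p.μ, p.ν⟩) (fun p => p.μ) hB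
  have s3 := hcount (fun p => ⟨p.src.shift p.ν, p.μ⟩) (fun p => p.ν) hC
  have s4 := hcount (fun p => ⟨p.src, p.ν⟩) (fun p => p.μ) hD
  calc ∑ p : Balaban1983to89.Plaq P j, |curl c δ p|
      ≤ ∑ p : Balaban1983to89.Plaq P j, |c| * (|δ ⟨p.src, p.μ⟩| + |δ ⟨p.src.shift p.μ, p.ν⟩|
          + |δ ⟨p.src.shift p.ν, p.μ⟩| + |δ ⟨p.src, p.ν⟩|) := sum_le_sum fun p _ => e1 p
    _ = |c| * (∑ p : Balaban1983to89.Plaq P j, |δ ⟨p.src, p.μ⟩| + ∑ p : Balaban1983to89.Plaq P j, |δ ⟨p.src.shift p.μ, p.ν⟩|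
          + ∑ p : Balaban1983to89.Plaq P j, |δ ⟨p.src.shift p.ν, p.μ⟩| + ∑ p : Balaban1983to89.Plaq P j, |δ ⟨p.src, p.ν⟩|) := by
        rw [← mul_sum, sum_add_distrib, sum_add_distrib, sum_add_distrib]
    _ ≤ |c| * (P.d + P.d + P.d + P.d) := by gcongr
    _ = 4 * P.d * |c| := by ring

/-- **`|(∂^*F)_b| ≤ 4d√w|c|·max|F|`** for the Hilbert-space adjoint of p09's weighted curl `curlOp w c = √w·∂` (`w ≥ 0`).
[cite: BalabanImbrieJaffe1985, (4.2.2) p.310] -/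
theorem abs_adjoint_curlOp_le (w c : ℝ) (F : PlaqSpace P) {C : ℝ} (hC : 0 ≤ C) (hF : ∀ p, |F p| ≤ C) (b : PBond P 0) :
    |LinearMap.adjoint (curlOp (P := P) w c) F b| ≤ 4 * P.d * (Real.sqrt w * |c|) * C := by
  classical
  refine (abs_adjoint_apply_le (curlOp (P := P) w c) hF b).trans (mul_le_mul_of_nonneg_right ?_ hC)
  have e1 : ∀ p : Balaban1983to89.Plaq P 0, curlOp (P := P) w c (EuclideanSpace.single b 1) p =
      Real.sqrt w * curl c (fun b' => if b' = b then (1 : ℝ) else 0) p := by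
    intro p
    show Real.sqrt w * curl c ((toE P).symm (EuclideanSpace.single b 1)) p = _
    congr 2
    funext b'
    show (EuclideanSpace.single b (1 : ℝ)) b' = _
    simp [PiLp.single_apply]
  simp_rw [e1, abs_mul, abs_of_nonneg (Real.sqrt_nonneg w), ← mul_sum]
  calc Real.sqrt w * ∑ p : Balaban1983to89.Plaq P 0, |curl c (fun b' => if b' = b then (1 : ℝ) else 0) p|
      ≤ Real.sqrt w * (4 * P.d * |c|) := mul_le_mul_of_nonneg_left (sum_abs_curl_single_le c b) (Real.sqrt_nonneg w)
    _ = 4 * P.d * (Real.sqrt w * |c|) := by ring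

/-- `|(curlOp w c A)(p)| ≤ 4√w|c|·max|A|` (`w ≥ 0`). [cite: BalabanImbrieJaffe1985, (4.1.1) p.309] -/
theorem abs_curlOp_le (w c : ℝ) (A : BondSpace P) {C : ℝ} (hA : ∀ b, |A b| ≤ C)
    (p : Balaban1983to89.Plaq P 0) :
    |curlOp (P := P) w c A p| ≤ 4 * (Real.sqrt w * |c|) * C := by
  show |Real.sqrt w * curl c ((toE P).symm A) p| ≤ _
  rw [abs_mul, abs_of_nonneg (Real.sqrt_nonneg w)]
  have h := abs_curl_le c ((toE P).symm A) (fun b => hA b) p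
  calc Real.sqrt w * |curl c ((toE P).symm A) p| ≤ Real.sqrt w * (4 * |c| * C) := mul_le_mul_of_nonneg_left h (Real.sqrt_nonneg w)
    _ = 4 * (Real.sqrt w * |c|) * C := by ring

/-! ## §3 `H₀ = I`, `𝒟₁ = C^{(0)}`, the row sums of `C^{(0)}`, and the residual property at `k = 1` -/

/-- **`H₀ = I`**: the Landau minimizer (4.4.2) with the zeroth-order averages — the constraint `Q₀A = B` with `Q₀ = I` leaves the single
configuration `A = B` (p. 312: *"they involve j^{th} order averages Q_j"*; `c ≠ 0`, `w > 0`). [cite: BalabanImbrieJaffe1985, (4.4.4) p.312] -/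
theorem HkE_zero (P : Params) {c : ℝ} (hc : c ≠ 0) {w : ℝ} (hw : 0 < w) : HkE P w c 0 = LinearMap.id := by
  apply LinearMap.ext
  intro B
  have hs : Real.sqrt w ≠ 0 := (Real.sqrt_pos.2 hw).ne'
  have h0 : 0 ≤ P.m + P.K := Nat.zero_le _
  rw [HkE_apply h0 hc hw B, LinearMap.id_apply]
  have h := (Hk_spec_V1 (P := P) h0 hc hs (WithLp.ofLp B)).1
  rw [opsV1_Qk] at h
  change WithLp.ofLp (Hk (opsV1 P 0 c (Real.sqrt w)) (WithLp.ofLp B)) = WithLp.ofLp B at h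
  exact WithLp.ofLp_injective 2 h

/-- **`𝒟₁ = C^{(0)}`** — (4.4.4) at `k = 1`: the single term `j = 0` with `H₀ = H₀^* = I` (`c ≠ 0`, `w > 0`).
[cite: BalabanImbrieJaffe1985, (4.4.4) p.312] -/
theorem DkE_one (P : Params) {c : ℝ} (hc : c ≠ 0) {w : ℝ} (hw : 0 < w) : DkE P w c 1 = CE P w c 0 := by
  rw [DkE, Finset.sum_range_one, HkE_zero P hc hw, LinearMap.adjoint_id]
  rfl

/-- **the row sums of `C^{(0)}` from (7.2.3)**: if `|⟨e_b, C^{(0)}e_{b′}⟩| ≤ M_Ce^{−δ_C|b₋ − b′₋|_∞}` for all bonds (p09's `ineq723_CE` at the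
native weights `(1, 1)` of the finest torus), then `Σ_{b′}|⟨e_b, C^{(0)}e_{b′}⟩| ≤ M_C·d·(2(1 + d/δ_C))^d` — uniformly in the size of the torus
(`B3TorusRadialSums.sum_exp_neg_supDist_le`; `δ_C > 0`). [cite: BalabanImbrieJaffe1985, (7.2.3) p.325] -/
theorem rowSum_CE_zero_le [DecidableEq (PBond P 0)] {MC δC : ℝ} (hδ : 0 < δC)
    (hC : ∀ b b' : PBond P 0, |⟪toEj P 0 (Pi.single b 1), CE P 1 1 0 (toEj P 0 (Pi.single b' 1))⟫| ≤
      MC * Real.exp (-(δC * (supDist b.src b'.src : ℝ))))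
    (b : PBond P 0) :
    ∑ b' : PBond P 0, |CE P 1 1 0 (EuclideanSpace.single b' 1) b| ≤ MC * (P.d * (2 * (1 + P.d / δC)) ^ P.d) := by
  have hMC : 0 ≤ MC := by
    have h := hC b b
    have h1 : 0 < Real.exp (-(δC * (supDist b.src b.src : ℝ))) := Real.exp_pos _
    nlinarith [abs_nonneg (⟪toEj P 0 (Pi.single b 1), CE P 1 1 0 (toEj P 0 (Pi.single b 1))⟫)]
  have e1 : ∀ b' : PBond P 0, |CE P 1 1 0 (EuclideanSpace.single b' 1) b| =
      |⟪toEj P 0 (Pi.single b 1), CE P 1 1 0 (toEj P 0 (Pi.single b' 1))⟫| := by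
    intro b'
    rw [inner_toEj_single_left, toEj_single]
  simp_rw [e1]
  set f : Balaban1983to89.Site P 0 → ℝ := fun y => Real.exp (-(δC * (supDist b.src y : ℝ))) with hf
  have hsum : ∑ b' : PBond P 0, f b'.src = ∑ q : Balaban1983to89.Site P 0 × Fin P.d, f q.1 :=
    Fintype.sum_equiv (⟨fun b' => (b'.src, b'.dir), fun q => ⟨q.1, q.2⟩, fun _ => rfl, fun _ => rfl⟩ :
      PBond P 0 ≃ Balaban1983to89.Site P 0 × Fin P.d) (fun b' => f b'.src) (fun q => f q.1) (fun _ => rfl)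
  calc ∑ b' : PBond P 0, |⟪toEj P 0 (Pi.single b 1), CE P 1 1 0 (toEj P 0 (Pi.single b' 1))⟫|
      ≤ ∑ b' : PBond P 0, MC * f b'.src := sum_le_sum fun b' _ => hC b b'
    _ = MC * ∑ q : Balaban1983to89.Site P 0 × Fin P.d, f q.1 := by rw [← mul_sum, hsum]
    _ = MC * (P.d * ∑ y : Balaban1983to89.Site P 0, f y) := by
        rw [Fintype.sum_prod_type]
        simp only [sum_const, card_univ, Fintype.card_fin, nsmul_eq_mul]
        rw [← mul_sum]
    _ ≤ MC * (P.d * (2 * (1 + P.d / δC)) ^ P.d) :=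
        mul_le_mul_of_nonneg_left (mul_le_mul_of_nonneg_left (sum_exp_neg_supDist_le hδ P.hd b.src) (Nat.cast_nonneg _)) hMC

/-- **THE RESIDUAL PROPERTY AT `k = 1` ON EVERY TORUS** (the located input `hR` of file B, DISCHARGED for the first step): there is
`K₁ = K₁(d, L) ≥ 0` such that on every torus `Setup` with `P.d = d ≥ 2`, `P.L = L`, `1 ≤ m + K`, for every unit-lattice plaquette field `g`
with `|g| ≤ C`: `|f₁(p)| = |((I − ∂𝒟₁∂^*)Q^{e*}g)(p)| ≤ K₁·C` (Euclidean encoding: `|resE(p)| ≤ K₁√w·C`, `w = η^d`, `c = η⁻¹ = L`).  Mechanism: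
`𝒟₁ = C^{(0)} = (wc²)⁻¹·C^{(0)}_{(1,1)}` (r18), the row sums of `C^{(0)}_{(1,1)}` from (7.2.3) (p09) and the radial sums, and the sup-norms of
`Q^{e*}` (`√wL²`), `∂^*` (`4d√wc`), `∂` (`4√wc`): `K₁ = L²(1 + 16d·M_C·d·(2(1+d/δ_C))^d)` — the weight factors `√w·√w·c·c/(wc²)` cancel exactly.
[cite: BalabanImbrieJaffe1985, (7.2.3) p.325] -/
theorem resBound_one (d L : ℕ) (hd : 2 ≤ d) :
    ∃ K : ℝ, 0 ≤ K ∧ ∀ (P : Params), P.d = d → P.L = L → 1 ≤ P.m + P.K → ∀ (hd2 : 2 ≤ P.d)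
      (g : Balaban1983to89.Plaq P 1 → ℝ) (C : ℝ), (∀ q, |g q| ≤ C) →
        ∀ p : Balaban1983to89.Plaq P 0,
          |resE hd2 ((P.eta 1) ^ P.d) (P.eta 1)⁻¹ 1 (toU P 1 g) p| ≤ K * Real.sqrt ((P.eta 1) ^ P.d) * C := by
  classical
  obtain ⟨MC, δC, hMC, hδC, H⟩ := ineq723_CE d L hd
  set R1 : ℝ := MC * (d * (2 * (1 + d / δC)) ^ d) with hR1
  have hR1nn : 0 ≤ R1 := by positivity
  refine ⟨(L : ℝ) ^ 2 * (1 + 16 * d * R1), by positivity, ?_⟩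
  intro P hP hPL hmK hd2 g C hg p
  have hC : 0 ≤ C := (abs_nonneg _).trans (hg ⟨default, ⟨0, by omega⟩, ⟨1, by omega⟩, by simp [Fin.lt_def]⟩)
  -- the weights of record at k = 1: w = η^d, c = η⁻¹ = L
  set w : ℝ := (P.eta 1) ^ P.d with hw
  have hwpos : 0 < w := pow_pos (eta_pos P 1) _
  have hs : 0 < Real.sqrt w := Real.sqrt_pos.2 hwpos
  have hc : (P.eta 1)⁻¹ = (P.L : ℝ) := by rw [eta_inv, pow_one]
  have hLpos : (0 : ℝ) < P.L := Nat.cast_pos.2 P.L_pos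
  have hcne : (P.eta 1)⁻¹ ≠ 0 := by rw [hc]; exact hLpos.ne'
  -- (7.2.3) at the finest scale j = 0, native weights (η₀^d, L⁰) = (1, 1)
  have hC0 : ∀ b b' : PBond P 0, |⟪toEj P 0 (Pi.single b 1), CE P 1 1 0 (toEj P 0 (Pi.single b' 1))⟫| ≤
      MC * Real.exp (-(δC * (supDist b.src b'.src : ℝ))) := by
    intro b b'
    have h := H P hP hPL 0 inferInstance (by omega) b b'
    simpa [Params.eta] using h
  have hrow : ∀ b : PBond P 0, ∑ b' : PBond P 0, |CE P 1 1 0 (EuclideanSpace.single b' 1) b| ≤ R1 := by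
    intro b
    have h := rowSum_CE_zero_le hδC hC0 b
    rw [hP] at h
    exact h
  -- step 1: |Q^{e*}F| ≤ √w L² C
  set F : UnitPlaqSpace P 1 := toU P 1 g with hF
  have h1 : ∀ q, |QesOp (P := P) hd2 w 1 F q| ≤ Real.sqrt w * (P.L : ℝ) ^ 2 * C := by
    intro q
    have := abs_QesOp_le hd2 w 1 F (C := C) (fun q' => hg q') q
    simpa using this
  -- step 2: |∂^*Q^{e*}F| ≤ 4d√w c · √w L² C
  set G : BondSpace P := LinearMap.adjoint (curlOp (P := P) w (P.eta 1)⁻¹) (QesOp (P := P) hd2 w 1 F) with hG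
  have h2 : ∀ b, |G b| ≤ 4 * P.d * (Real.sqrt w * |(P.eta 1)⁻¹|) * (Real.sqrt w * (P.L : ℝ) ^ 2 * C) := fun b =>
    abs_adjoint_curlOp_le _ _ _ (by positivity) h1 b
  -- step 3: |𝒟₁G| = |(wc²)⁻¹ C^{(0)}_{(1,1)} G| ≤ (wc²)⁻¹ R1 · (...)
  have hD : DkE P w (P.eta 1)⁻¹ 1 G = (w * (P.eta 1)⁻¹ ^ 2)⁻¹ • CE P 1 1 0 G := by
    rw [DkE_one P hcne hwpos, cE_eq_smul_cE_one hwpos hcne, LinearMap.smul_apply]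
  have hwc : 0 < w * (P.eta 1)⁻¹ ^ 2 := by positivity
  have h3 : ∀ b, |DkE P w (P.eta 1)⁻¹ 1 G b| ≤
      (w * (P.eta 1)⁻¹ ^ 2)⁻¹ * (R1 * (4 * P.d * (Real.sqrt w * |(P.eta 1)⁻¹|) * (Real.sqrt w * (P.L : ℝ) ^ 2 * C))) := by
    intro b
    rw [hD, PiLp.smul_apply, smul_eq_mul, abs_mul, abs_of_pos (inv_pos.2 hwc)]
    refine mul_le_mul_of_nonneg_left ?_ (inv_pos.2 hwc).le
    refine (abs_apply_le_rowSum (CE P 1 1 0) h2 b).trans ?_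
    exact mul_le_mul_of_nonneg_right (hrow b) (by positivity)
  -- step 4: |∂𝒟₁G| ≤ 4√w c · (...)
  have h4 := abs_curlOp_le w (P.eta 1)⁻¹ _ h3 p
  -- assemble: resE = Q^{e*}F − ∂𝒟₁∂^*Q^{e*}F
  rw [resE_eq_DkE hd2 hmK hcne hwpos, PiLp.sub_apply]
  refine (abs_sub _ _).trans ?_
  refine (add_le_add (h1 p) h4).trans (le_of_eq ?_)
  rw [hc, abs_of_pos hLpos, hPL, hP]
  have hL' : (0 : ℝ) < L := by rw [← hPL]; exact hLpos
  have hsq : w = Real.sqrt w ^ 2 := (Real.sq_sqrt hwpos.le).symm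
  clear_value w F G
  generalize Real.sqrt w = s at hs hsq ⊢
  subst hsq
  field_simp
  ring

/-! ## §4 The actual first-step family and `Claim73` for it -/

/-- the residual constant `K₁(d, L)` of `resBound_one`. [cite: BalabanImbrieJaffe1985, (7.2.3) p.325] -/
def K1 (d L : ℕ) (hd : 2 ≤ d) : ℝ := Classical.choose (resBound_one d L hd)

/-- kernel: the defining property of `K₁`. [cite: BalabanImbrieJaffe1985, (7.2.3) p.325] -/
theorem K1_spec (d L : ℕ) (hd : 2 ≤ d) :
    0 ≤ K1 d L hd ∧ ∀ (P : Params), P.d = d → P.L = L → 1 ≤ P.m + P.K → ∀ (hd2 : 2 ≤ P.d)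
      (g : Balaban1983to89.Plaq P 1 → ℝ) (C : ℝ), (∀ q, |g q| ≤ C) →
        ∀ p : Balaban1983to89.Plaq P 0,
          |resE hd2 ((P.eta 1) ^ P.d) (P.eta 1)⁻¹ 1 (toU P 1 g) p| ≤ K1 d L hd * Real.sqrt ((P.eta 1) ^ P.d) * C :=
  Classical.choose_spec (resBound_one d L hd)

/-- Index of the family of ACTUAL FIRST-STEP Sect. 7.3 data: any torus `Setup` of dimension `d` and block size `L` with at least one block level
(`1 ≤ m + K`), the coupling `0 < e ≤ 1`, and ANY unit-lattice `U(1)` field `v` on `T^{(1)}` — no further hypothesis.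
[cite: BalabanImbrieJaffe1985, (3.8) p.306] -/
structure OneIdx (d L : ℕ) where
  P : Params
  hd : P.d = d
  hL : P.L = L
  hd2 : 2 ≤ P.d
  hmK : 1 ≤ P.m + P.K
  e : ℝ
  he : 0 < e
  he1 : e ≤ 1
  v : U1Field P 1

/-- **every first-step index is an index of file B's family at the residual constant `K₁(d, L)`** — the located input `hR` DISCHARGED by
`resBound_one`. [cite: BalabanImbrieJaffe1985, (7.3.1) p.326] -/
def OneIdx.toResIdx {d L : ℕ} (hd : 2 ≤ d) (i : OneIdx d L) : ResIdx d (K1 d L hd) where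
  P := i.P
  hd := i.hd
  hd2 := i.hd2
  k := 1
  hk1 := le_rfl
  hk := i.hmK
  e := i.e
  he := i.he
  he1 := i.he1
  v := i.v
  hR := fun g C hg p => (K1_spec d L hd).2 i.P i.hd i.hL i.hmK i.hd2 g C hg p

/-- **THE FIRST RENORMALIZATION STEP: r15's typed claim of Sect. 7.3 `Claim73 𝓅` — "(7.3.1) ⇒ (7.3.2) for constants γ > 0, α > 0, M < ∞" —
PROVED, WITH NO LOCATED HYPOTHESIS, for the family of ACTUAL data at `k = 1`**: every torus of dimension `d ≥ 2` and block size `L`, every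
`0 < e ≤ 1`, EVERY unit-lattice `U(1)` field `v`, the background being `u₁ = Q^{s*}v·exp[−ieη(𝒟₁∂^*Q^{e*}f^{(1)})]` of (4.5.4) ((3.15)/(3.21) of
Sect. 3) computed from `v` with the operators of record, the hypothesis being the printed (7.3.1) `|v(∂p′) − 1| ≤ e𝓅(e)`, the conclusion the
first printed form of (7.3.2) for `⟨ψ, Δ₁(u₁)ψ⟩` — p. 306 *"we will establish strict positivity of … Δ₁(u₁)"* in the (7.3.2) sense.  Constants:
`γ = min(a/(9(d+1)), 1/12)`, `α = ½`, `M = (4/3)d⁴((π/2)K₁(d,L))²(1+4𝓅₊)^{2𝓅₊}`. [cite: BalabanImbrieJaffe1985, (7.3.1)–(7.3.2) p.326] -/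
theorem claim73_actual_one {d L : ℕ} (hd : 2 ≤ d) (a : ℝ) (ha : 0 < a) (pexp : ℝ) :
    BIJ85Sect7Statements.ScalarStabData.Claim73 pexp (fun i : OneIdx d L => resStabData a ha (i.toResIdx hd)) := by
  obtain ⟨γ, α, M, hγ, hα, H⟩ := claim73_residual (d := d) a ha (K1 d L hd) pexp
  exact ⟨γ, α, M, hγ, hα, fun i hi => H (i.toResIdx hd) hi⟩

/-- kernel: the hypothesis of the family IS the printed (7.3.1) on the unit-lattice field `v` — `|v(∂p′) − 1| ≤ e(1 + ln e^{−1})^𝓅` for every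
plaquette `p′` of `T^{(1)}`. [cite: BalabanImbrieJaffe1985, (7.3.1) p.326] -/
theorem hyp731_one_iff {d L : ℕ} (hd : 2 ≤ d) (a : ℝ) (ha : 0 < a) (pexp : ℝ) (i : OneIdx d L) :
    (resStabData a ha (i.toResIdx hd)).Hyp731 pexp ↔
      ∀ p' : Balaban1983to89.Plaq i.P 1, ‖((plaq i.v p' : Circle) : ℂ) - 1‖ ≤ i.e * (1 + Real.log i.e⁻¹) ^ pexp :=
  Iff.rfl

/-- kernel: the family is inhabited and its hypothesis is satisfiable — at `v = 1` (all plaquette variables `1`) (7.3.1) holds for every `𝓅` on any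
torus with a block level. [cite: BalabanImbrieJaffe1985, (7.3.1) p.326] -/
theorem hyp731_one_trivial {d L : ℕ} (hd : 2 ≤ d) (a : ℝ) (ha : 0 < a) (pexp : ℝ) (P : Params) (hP : P.d = d) (hPL : P.L = L)
    (hd2 : 2 ≤ P.d) (hmK : 1 ≤ P.m + P.K) :
    (resStabData a ha ((⟨P, hP, hPL, hd2, hmK, 1, one_pos, le_rfl, 1⟩ : OneIdx d L).toResIdx hd)).Hyp731 pexp := by
  rw [hyp731_one_iff]
  intro p'
  have h1 : plaq (1 : U1Field P 1) p' = 1 := by simp [plaq]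
  rw [h1]
  simp

end

end Literature.MathematicalPhysics.QuantumFieldTheory.BalabanImbrieJaffe1984to88.BIJ85Claim73ActualOne
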